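import Summits.QuantumFields.YangMills.Theorems.UnitScaleTiltProp7GaugeProjectorBlockPackage
import HarnessLib

/-!
# Route `UnitScaleTilt`, crux K1 «MinimiserStabilityRegPr» (stmt-QuantumFields-19200), EX row (4) `h88` — **(c4w)-LETTERS: THE AGMON-WEIGHTED GRADIENT ROW OF `R_S G′ᴾ`,
# `‖(D_{U₀}R_SG′ᴾ_{a′} g)(b)‖ ≤ R_w(1 + S_w B_w)·|g|_E·E_z(b₋)` — THE ORDER-SWAPPED TWIN OF px5's (c2w) `D G′ᴾ R_S` (✓`Prop7GaugeProjectorBlockPackage.hc2w_of_letters`)**, i.e. the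
# weighted edition of the hPcol storey's `hrow` (✓`Prop7PcolOfGradientRow.gradient_row_of_letters` = its rate-0 case); the ONE analytic letter of the h88-DOOR
# (✓∕⧗`Prop7H88DoorOfH137H133.h88_of_h137k_h133_c4w`, ★p1 g28 CHAIR LOCATE №41).

Cell `ym3-torus` (HUMAN RULING D-0037; rung R3 = SU(2) YM₃ on T³ — NOT d = 4, NOT infinite volume, NOT a mass gap, NOT Clay).  Fleet lead ∕ chair seat `ym-ust-19200-p1` (gen 28).
THEOREMS ONLY (0 `def`, 0 `sorry`, default heartbeats); `--supports stmt-QuantumFields-19200 --as helper`; count-neutral.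

THE MATHEMATICS ([Balaban1985BackgroundPropagators] (3.21)–(3.25), Thm 3.1 (3.42); [Balaban1985Variational] (138)–(139) «`G′RD*` bounded in `|·|₍₁₎`», read dually as a ROW).
Under Lift, (Z0) ✓`DL2_RS_GprimeP_eq_DL2_RS_G` (`D R_S G′ᴾ_{a′} = D R_S G_a`: no `P₀`) and P3v's SOURCE FORM of the complementary projector (`(1 − R_S)v = G_a(T c(v))`, so
`R_S(G_a g) = G_a(g − T c(G_a g))` — ✓P4 `RS_G_eq_of_sourceForm`) put the gradient on `G_a` ALONE: `D R_S G′ᴾ g = D G_a f`, `f := g − T c(G_a g)`.  With the three RATE-PRESERVING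
weighted letters — GRADIENT `hDw` (`|D G_a f|(b) ≤ R_w|f|_E E_z(b₋)`, ✓W4 §3 `hDw_of_letters`), VALUE `hGw` (`|G_a f| ≤ B_w|f|_E E_z`, ✓W1 `hGsupW_of_regPr`) and the NEW SOURCE letter `hSw`
(`|T c(v)| ≤ S_w|v|_E E_z` — the weighted edition of ✓P3v `norm_equiv_complementary_source_apply_le`, px13 g16's (src-κ)) — `|f|_E ≤ (1 + S_w B_w)|g|_E`, hence (c4).
No kernel entry, no Hölder norm, no `log ℓ`.

WHAT IS PROVED (ns `Summit.QuantumFields.YangMills.Theorems.Prop7GaugeProjectorGradientRowSwapped`; LOD∕Lift letters `Q″ hseq ι T hT G hAG hGA hRS hker` VERBATIM as ✓W4 ∕ (Z0);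
`G′ᴾ`'s parameter `0 ≤ a′` free of the LOD mass `a`; rate `κ`; displayed letters `hGw hDw` (W4's texts VERBATIM) and `hSw` with an abstract source map `c` and its identity `hsrcid`).
* §1 (fibre currency): `norm_equiv_source_le_of_weighted` (`|g − T c(G_a g)|_E ≤ (1 + S_w B_w)|g|_E`), ★★ `norm_equiv_DL2_RS_GprimeP_le_of_weighted` ((c4): `R_w(1 + S_w B_w)`).
* §2 (route currency): ★★★ **`hc4w_of_letters`** = the h88-DOOR's `hc4w` binder text VERBATIM (`∀ z v m, 0 ≤ m → (∀ x, ‖v x‖ ≤ m·e^{−κ·tdist(B x, z)}) → ∀ b, ‖toL2⁻¹(D_{U₀}(R_S(G′ᴾ_{a′}(toL2S v)))) b‖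
  ≤ C₄·m·e^{−κ·tdist(B b₋, z)}`) with `C₄ := √2·R_w·(1 + S_w·B_w)`; ★★★ **`hc4b_of_letters`** — the BLOCK-SUPPORTED edition (`v ⊂ B(z)`, `‖v y‖ ≤ m` ⟹ `m·C₄·e^{−κ·tdist}`).
HYP-SAT (★★OWNER RULING №42).  LOD∕Lift letters: inhabited as in ✓W4∕(Z0) (`hseq hT hAG hGA` ⟸ ✓`exists_intertwiner_of_regPr`∕✓`exists_massive_inverse`; `hRS hker` ⟸ ✓`RS_eq_projR_of_lift`
under the Lift antecedent).  `hsrcid` ⟸ ✓P3v `sub_projR_eq_G_lift_coeffSum` at `c := Σ_i λ_i(·)•b i`; `hGw` ⟸ ✓W1 `hGsupW_of_regPr`; `hDw` ⟸ ✓W4 §3 `hDw_of_letters` + `hroom`∕`hsmall`; `hSw` ⟸ px13 g16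
(src-κ) (the weighted P3v); all real-inequality schemas with K-free constants at the pin (at `f = 0` they force only `0 ≤ R_w, B_w, S_w·…` — non-vacuous, no `Prop` placeholder).
HONEST SCOPE.  Algebra + readings over landed∕displayed letters; nothing of (src-κ), h88, the 8 EX rows, EX `stub_existenceMinimalOrbit`, the crux or the rung is proved here;
the Yang–Mills mass gap is NOT proved.

References: T. Bałaban, CMP **99** (1985) 389–434 [Balaban1985BackgroundPropagators] ((3.21)–(3.25) p.394, Thm 3.1 (3.42)∕(3.46) pp.397–398, (3.49) p.399, (3.118)–(3.122)
pp.419–420); CMP **102** (1985) 277–309 [Balaban1985Variational] ((138)–(139) p.299).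
-/

set_option autoImplicit false

noncomputable section

open scoped BigOperators Matrix.Norms.L2Operator InnerProductSpace ComplexConjugate Matrix

namespace Summit.QuantumFields.YangMills.Theorems.Prop7GaugeProjectorGradientRowSwapped

open Literature.MathematicalPhysics.QuantumFieldTheory.Balaban1983to89
open Literature.MathematicalPhysics.QuantumFieldTheory.Balaban1983to89.T3ContinuumYM3Torus
open T4Continuum BlockAveraging
open BlockAveraging (Idx off)
open B7Prop1Explicit (disp)
open B5Eq118OneStroke (iterBlockOf)
open B10Eq27TorusAxialLog (holT transl)
open B7TransferAnalyticMean (meanCLM)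
open B4Sect5Torus (TSite)
open B9SectCLatticeCarrier (Bond)
open B9Eq311L2Pairing (WL2)
open B11Eq103H1Complex (SiteL2K BondL2K projR)
open Summit.QuantumFields.YangMills.Theorems.Prop8Chart (emlIterU)
open T3SectALandauChart (eta bgUnits)
open T3PrintedRegularMinimiser (RegPr)
open Summit.QuantumFields.YangMills.Theorems.Prop7SectET3Transport (periodsT3 siteEquiv bondEquiv)
open Summit.QuantumFields.YangMills.Theorems.Prop7SectET3HilbertLetters (W₂ frobEquiv toL2 toL2S DL2 DstarL2 covLapSite toL2S_apply toL2S_symm_apply toL2_symm_apply)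
open Summit.QuantumFields.YangMills.Theorems.Prop7RieszTauFrobNorm (norm_frobEquiv_symm_le norm_frobEquiv_le)
open Summit.QuantumFields.YangMills.Theorems.Prop7SectET3GaugeProjector (NS RS)
open Summit.QuantumFields.YangMills.Theorems.Prop7SectET3DeltaPiPInv (GprimeP)
open Summit.QuantumFields.YangMills.Theorems.Prop7ZeroModesOrthKerTopMean (DL2_RS_GprimeP_eq_DL2_RS_G)
open Summit.QuantumFields.YangMills.Theorems.Prop7GaugeProjectorBlockPackage (norm_equiv_toL2S_le_of_weighted weighted_of_blockSupported_source)

variable (F : T3Family) {n K : ℕ} (h : n ≤ K) {c₀ c₁ cB : ℝ} [Fact (0 < c₀)] [Fact (0 < c₁)] [Fact (0 < cB)]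
  (U₀ : GaugeField (F.P K) 0 (Matrix.specialUnitaryGroup (Fin 2) ℂ))
  (Q'' : SiteL2K ℂ 3 (periodsT3 F K) c₀ W₂ →ₗ[ℂ] (Site (F.P K) (K - n) → Matrix (Fin 2) (Fin 2) ℂ))
  (hseq : ∀ lam : Site (F.P K) 0 → Matrix (Fin 2) (Fin 2) ℂ, ∃ ns : (j : ℕ) → Site (F.P K) j → Matrix (Fin 2) (Fin 2) ℂ, ns 0 = lam ∧
      (∀ (j : ℕ) (y : Site (F.P K) (j + 1)), ns (j + 1) y = ns j (emb y) - meanCLM (Idx (F.P K)) (Matrix (Fin 2) (Fin 2) ℂ) fun i : Idx (F.P K) =>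
        ns j (emb y) - ((holT (emlIterU j (bgUnits F K U₀)) (emb y) (stairWord i.2.1 (off i.1)) : (Matrix (Fin 2) (Fin 2) ℂ)ˣ) : Matrix (Fin 2) (Fin 2) ℂ) *
          ns j (transl (emb y) (disp (stairWord i.2.1 (off i.1)))) * (((holT (emlIterU j (bgUnits F K U₀)) (emb y) (stairWord i.2.1 (off i.1)))⁻¹ : (Matrix (Fin 2) (Fin 2) ℂ)ˣ) : Matrix (Fin 2) (Fin 2) ℂ)) ∧
      ns (K - n) = Q'' (toL2S F K c₀ lam))
  (ι : (Site (F.P K) (K - n) → Matrix (Fin 2) (Fin 2) ℂ) →ₗ[ℂ] SiteL2K ℂ 3 (periodsT3 F n) c₁ W₂)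
  (T : SiteL2K ℂ 3 (periodsT3 F n) c₁ W₂ →ₗ[ℂ] SiteL2K ℂ 3 (periodsT3 F K) c₀ W₂)
  (hT : ∀ (l : SiteL2K ℂ 3 (periodsT3 F K) c₀ W₂) (f : SiteL2K ℂ 3 (periodsT3 F n) c₁ W₂), ⟪ι (Q'' l), f⟫_ℂ = ⟪l, T f⟫_ℂ)
  {a : ℝ}
  (G : SiteL2K ℂ 3 (periodsT3 F K) c₀ W₂ →ₗ[ℂ] SiteL2K ℂ 3 (periodsT3 F K) c₀ W₂)
  (hAG : ∀ f, covLapSite F n K c₀ U₀ (G f) + (a : ℂ) • T (ι (Q'' (G f))) = f)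
  (hGA : ∀ u, G (covLapSite F n K c₀ U₀ u + (a : ℂ) • T (ι (Q'' u))) = u)
  (hRS : RS F n K h c₀ cB U₀ = projR (covLapSite F n K c₀ U₀) Q'')
  (hker : LinearMap.ker Q'' ≤ NS F n K h c₀ cB U₀)
  (c : SiteL2K ℂ 3 (periodsT3 F K) c₀ W₂ → SiteL2K ℂ 3 (periodsT3 F n) c₁ W₂)
  (hsrcid : ∀ v, v - projR (covLapSite F n K c₀ U₀) Q'' v = G (T (c v)))
  {κ Bw Rw Sw : ℝ}
  (hGw : ∀ (f : SiteL2K ℂ 3 (periodsT3 F K) c₀ W₂) (z : Site (F.P K) (K - n)) (Fb : ℝ),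
    (∀ x : Site (F.P K) 0, ‖WL2.equiv ℂ _ W₂ f (siteEquiv F K x)‖ ≤ Fb * Real.exp (-(κ * (Site.tdist (P := F.P K) (iterBlockOf (K - n) x) z : ℝ)))) →
    ∀ x : Site (F.P K) 0, ‖WL2.equiv ℂ _ W₂ (G f) (siteEquiv F K x)‖ ≤ Bw * Fb * Real.exp (-(κ * (Site.tdist (P := F.P K) (iterBlockOf (K - n) x) z : ℝ))))
  (hDw : ∀ (f : SiteL2K ℂ 3 (periodsT3 F K) c₀ W₂) (z : Site (F.P K) (K - n)) (Fb : ℝ),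
    (∀ x : Site (F.P K) 0, ‖WL2.equiv ℂ _ W₂ f (siteEquiv F K x)‖ ≤ Fb * Real.exp (-(κ * (Site.tdist (P := F.P K) (iterBlockOf (K - n) x) z : ℝ)))) →
    ∀ b : PBond (F.P K) 0, ‖WL2.equiv ℂ _ W₂ (DL2 F n K c₀ U₀ (G f)) (bondEquiv F K b)‖ ≤ Rw * Fb * Real.exp (-(κ * (Site.tdist (P := F.P K) (iterBlockOf (K - n) b.src) z : ℝ))))
  (hSw : ∀ (f : SiteL2K ℂ 3 (periodsT3 F K) c₀ W₂) (z : Site (F.P K) (K - n)) (Fb : ℝ),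
    (∀ x : Site (F.P K) 0, ‖WL2.equiv ℂ _ W₂ f (siteEquiv F K x)‖ ≤ Fb * Real.exp (-(κ * (Site.tdist (P := F.P K) (iterBlockOf (K - n) x) z : ℝ)))) →
    ∀ x : Site (F.P K) 0, ‖WL2.equiv ℂ _ W₂ (T (c f)) (siteEquiv F K x)‖ ≤ Sw * Fb * Real.exp (-(κ * (Site.tdist (P := F.P K) (iterBlockOf (K - n) x) z : ℝ))))

/-! ## §1 The knit in the fibre currency -/

include hGw hSw in
omit [Fact (0 < c₀)] [Fact (0 < c₁)] [Fact (0 < cB)] in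
/-- **THE SOURCE OF THE SWAPPED WORD KEEPS THE WEIGHT, `1 + S_w B_w`**: `‖(g − T c(G_a g))(x)‖ ≤ (1 + S_w·B_w)·G_b·E_z(x)` from the VALUE letter and the SOURCE letter.
[cite: Balaban1985BackgroundPropagators, (3.21)–(3.25) p.394, Thm 3.1 (3.42) p.397] -/
theorem norm_equiv_source_le_of_weighted (g : SiteL2K ℂ 3 (periodsT3 F K) c₀ W₂) (z : Site (F.P K) (K - n)) (Gb : ℝ)
    (hg : ∀ x : Site (F.P K) 0, ‖WL2.equiv ℂ _ W₂ g (siteEquiv F K x)‖ ≤ Gb * Real.exp (-(κ * (Site.tdist (P := F.P K) (iterBlockOf (K - n) x) z : ℝ)))) :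
    ∀ x : Site (F.P K) 0, ‖WL2.equiv ℂ _ W₂ (g - T (c (G g))) (siteEquiv F K x)‖
      ≤ (1 + Sw * Bw) * Gb * Real.exp (-(κ * (Site.tdist (P := F.P K) (iterBlockOf (K - n) x) z : ℝ))) := by
  intro x
  have hS := hSw (G g) z (Bw * Gb) (hGw g z Gb hg) x
  rw [WL2.equiv_sub, Pi.sub_apply]
  calc _ ≤ Gb * Real.exp (-(κ * (Site.tdist (P := F.P K) (iterBlockOf (K - n) x) z : ℝ)))
        + Sw * (Bw * Gb) * Real.exp (-(κ * (Site.tdist (P := F.P K) (iterBlockOf (K - n) x) z : ℝ))) := (norm_sub_le _ _).trans (add_le_add (hg x) hS)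
    _ = _ := by ring

include hseq hT hAG hGA hRS hker hsrcid hGw hDw hSw in
/-- ★★ **(c4) IN THE FIBRE CURRENCY — `‖(D_{U₀}R_S G′ᴾ_{a′} g)(b)‖ ≤ R_w(1 + S_w B_w)·G_b·E_z(b₋)`**: (Z0) ✓`DL2_RS_GprimeP_eq_DL2_RS_G` (`D R_S G′ᴾ = D R_S G_a`), the source form
`R_S(G_a g) = G_a(g − T c(G_a g))` (`hRS` + `hsrcid`, as ✓P4 `RS_G_eq_of_sourceForm`), then the GRADIENT letter `hDw` on that source (§1's weight).
[cite: Balaban1985BackgroundPropagators, (3.21)–(3.25) p.394, Thm 3.1 (3.42) p.397; Balaban1985Variational, (138)–(139) p.299] -/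
theorem norm_equiv_DL2_RS_GprimeP_le_of_weighted {a' : ℝ} (ha' : 0 ≤ a') (g : SiteL2K ℂ 3 (periodsT3 F K) c₀ W₂) (z : Site (F.P K) (K - n)) (Gb : ℝ)
    (hg : ∀ x : Site (F.P K) 0, ‖WL2.equiv ℂ _ W₂ g (siteEquiv F K x)‖ ≤ Gb * Real.exp (-(κ * (Site.tdist (P := F.P K) (iterBlockOf (K - n) x) z : ℝ)))) :
    ∀ b : PBond (F.P K) 0, ‖WL2.equiv ℂ _ W₂ (DL2 F n K c₀ U₀ (RS F n K h c₀ cB U₀ (GprimeP F n K h c₀ cB a' U₀ g))) (bondEquiv F K b)‖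
      ≤ Rw * (1 + Sw * Bw) * Gb * Real.exp (-(κ * (Site.tdist (P := F.P K) (iterBlockOf (K - n) b.src) z : ℝ))) := by
  intro b
  -- no `P₀`: `D R_S G′ᴾ g = D R_S G_a g`; source form: `R_S(G_a g) = G_a(g − T c(G_a g))`
  have hRSG : RS F n K h c₀ cB U₀ (G g) = G (g - T (c (G g))) := by
    rw [hRS, map_sub, ← hsrcid (G g), sub_sub_cancel]
  rw [DL2_RS_GprimeP_eq_DL2_RS_G F h U₀ Q'' hseq ι T hT G hAG hGA hRS hker ha' g, hRSG]
  exact (hDw _ z _ (norm_equiv_source_le_of_weighted F T G c hGw hSw g z Gb hg) b).trans (le_of_eq (by ring))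

/-! ## §2 The route currency: weighted sources (c4w) and block-supported sources (c4b) -/

include hseq hT hAG hGA hRS hker hsrcid hGw hDw hSw in
/-- ★★★ **(c4w) — THE h88-DOOR's WEIGHTED LETTER `hc4w` BY TEXT**: `‖v x‖ ≤ m·e^{−κ·tdist(B x, z)}` ⟹ `‖(toL2⁻¹(D_{U₀}(R_S(G′ᴾ_{a′}(toL2S v)))))(b)‖ ≤ (√2·R_w(1+S_wB_w))·m·e^{−κ·tdist(B b₋, z)}`.
[cite: Balaban1985BackgroundPropagators, (3.21)–(3.25) p.394, Thm 3.1 (3.42) p.397; Balaban1985Variational, (138)–(139) p.299] -/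
theorem hc4w_of_letters {a' : ℝ} (ha' : 0 ≤ a') :
    ∀ (z : Site (F.P K) (K - n)) (v : Site (F.P K) 0 → Matrix (Fin 2) (Fin 2) ℂ) (m : ℝ), 0 ≤ m →
      (∀ x, ‖v x‖ ≤ m * Real.exp (-(κ * (Site.tdist (P := F.P K) (iterBlockOf (K - n) x) z : ℝ)))) →
      ∀ b : PBond (F.P K) 0, ‖(toL2 F K c₀).symm (DL2 F n K c₀ U₀ (RS F n K h c₀ cB U₀ (GprimeP F n K h c₀ cB a' U₀ (toL2S F K c₀ v)))) b‖
        ≤ (Real.sqrt 2 * (Rw * (1 + Sw * Bw))) * m * Real.exp (-(κ * (Site.tdist (P := F.P K) (iterBlockOf (K - n) b.src) z : ℝ))) := by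
  intro z v m _ hv b
  rw [toL2_symm_apply]
  refine (norm_frobEquiv_le _).trans ?_
  exact (norm_equiv_DL2_RS_GprimeP_le_of_weighted F h U₀ Q'' hseq ι T hT G hAG hGA hRS hker c hsrcid hGw hDw hSw ha' _ z _
    (norm_equiv_toL2S_le_of_weighted F v z m hv) b).trans (le_of_eq (by ring))

include hseq hT hAG hGA hRS hker hsrcid hGw hDw hSw in
/-- ★★★ **(c4b) — THE BLOCK-SUPPORTED EDITION**: for `v` supported in `B(z)` with `‖v y‖ ≤ m` (`0 ≤ m`),
`‖(toL2⁻¹(D_{U₀}(R_S(G′ᴾ_{a′}(toL2S v)))))(b)‖ ≤ m·(√2·R_w(1+S_wB_w))·e^{−κ·tdist(B b₋, z)}`. [cite: Balaban1985BackgroundPropagators, (3.25) p.394, Thm 3.1 (3.42) p.397, (3.49) p.399] -/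
theorem hc4b_of_letters {a' : ℝ} (ha' : 0 ≤ a') :
    ∀ (v : Site (F.P K) 0 → Matrix (Fin 2) (Fin 2) ℂ) (z : Site (F.P K) (K - n)), (∀ y, v y ≠ 0 → iterBlockOf (K - n) y = z) →
      ∀ m : ℝ, 0 ≤ m → (∀ y, ‖v y‖ ≤ m) →
        ∀ b : PBond (F.P K) 0, ‖(toL2 F K c₀).symm (DL2 F n K c₀ U₀ (RS F n K h c₀ cB U₀ (GprimeP F n K h c₀ cB a' U₀ (toL2S F K c₀ v)))) b‖
          ≤ m * (Real.sqrt 2 * (Rw * (1 + Sw * Bw))) * Real.exp (-(κ * (Site.tdist (P := F.P K) (iterBlockOf (K - n) b.src) z : ℝ))) := by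
  intro v z hvz m hm hv b
  exact (hc4w_of_letters F h U₀ Q'' hseq ι T hT G hAG hGA hRS hker c hsrcid hGw hDw hSw ha' z v m hm (weighted_of_blockSupported_source F v z hvz m hm hv) b).trans
    (le_of_eq (by ring))

end Summit.QuantumFields.YangMills.Theorems.Prop7GaugeProjectorGradientRowSwapped

end
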